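import Literature.Analysis.Calculus.MatrixFieldDeriv
import HarnessLib

/-!
# The coordinate Laplacian in divergence form:
# `√g · gⁱʲ(∂ᵢ∂ⱼf − Γᵏᵢⱼ ∂ₖf) = ∂ᵢ(√g gⁱˡ ∂ₗ f)`

Topic `Literature/Analysis/Calculus` (pure multivariable calculus; the geometric reading is in
`Literature/Geometry/Lorentzian/`). Let `G : E → (ι → ι → ℝ)` be a field of symmetric matrices
on a real normed space `E`, differentiable at `y` with `det G(y) > 0`, let `e : ι → E` be fixed
directions (`∂ᵢ = D(·)(eᵢ)`), and let `f : E → ℝ` be twice differentiable at `y`. With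
`gⁱʲ = (G⁻¹)ᵢⱼ`, `√g = √(det G)` and the Christoffel symbols of the first kind
`Γᵢⱼₖ = ½(∂ᵢ G_{jk} + ∂ⱼ G_{ik} − ∂ₖ G_{ij})` (so that `Γˡᵢⱼ = Γᵢⱼₖ gᵏˡ`), the classical identity

  `√g · ∑ᵢⱼ gⁱʲ (∂ᵢ∂ⱼ f − ∑ₗ (∑ₖ Γᵢⱼₖ gᵏˡ) ∂ₗ f) = ∑ᵢ ∂ᵢ (√g ∑ₗ gⁱˡ ∂ₗ f)`      (∗)

holds at `y` (`coordLaplacian_mul_sqrt_det_eq_sum_fderiv`): the Laplace–Beltrami operator written through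
the Hessian, `Δu = tr_g(∇²u) = gⁱʲ u_{;ij} = gⁱʲ(∂ᵢ∂ⱼu − Γᵏᵢⱼ ∂ₖu)` (Lee, *Introduction to
Riemannian Manifolds* (2018), Problem 5-14, (5.28)–(5.29)), equals the divergence form
`Δu = (1/√det g) ∂ᵢ(gⁱʲ √det g ∂ⱼu)` (Lee 2018, Prop. 2.46). The proof is the contracted
Christoffel identity `gⁱʲ Γˡᵢⱼ = −(1/√g) ∂ᵢ(√g gⁱˡ)`, i.e.

  `−∑ᵢⱼₖ gⁱʲ Γᵢⱼₖ gᵏˡ = ∑ᵢ (½ tr(g⁻¹ ∂ᵢG) gⁱˡ − (g⁻¹ (∂ᵢG) g⁻¹)ᵢₗ)`      (`christoffel_contraction`)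

(pure algebra for symmetric `g⁻¹`, `∂ᵢG`), combined with Jacobi's formula
`∂ᵢ √g = ½ √g tr(g⁻¹ ∂ᵢ G)` and `∂ᵢ g⁻¹ = −g⁻¹ (∂ᵢG) g⁻¹` (`MatrixFieldDeriv.lean`).

Everything is proved; no definitions. The directions `eᵢ` need not form a basis and `E` need not
be finite-dimensional: (∗) is an identity between directional derivatives along the `eᵢ` of
expressions indexed by the same finite type `ι` as the matrices.

## References

* J. M. Lee, *Introduction to Riemannian Manifolds*, 2nd ed., GTM 176, Springer 2018, Prop. 2.46
  (p. 33: `Δu = (1/√det g) ∂ᵢ(gⁱʲ √det g ∂ⱼ u)` in coordinates) and Problem 5-14, (5.28)–(5.29)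
  (`Δu = tr_g(∇²u) = gⁱʲ u_{;ij}`) (key `Lee2018`).
* J. R. Magnus, H. Neudecker, *Matrix Differential Calculus*, 3rd ed. 2019, Ch. 8 (Jacobi's
  formula, `dX⁻¹`) (key `MagnusNeudecker2019`).
-/

noncomputable section

open Matrix Function Finset Filter
open scoped Topology

namespace Literature.Analysis.Calculus

variable {ι : Type*} [Fintype ι] [DecidableEq ι]

/-! ### The contracted Christoffel identity (algebra) -/

omit [DecidableEq ι] in
/-- **The contracted Christoffel identity, algebraic form.** For a symmetric matrix `gi` (the
inverse metric `gⁱʲ`) and symmetric matrices `dG i` (the derivatives `∂ᵢ G`), with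
`Γᵢⱼₖ = ½((dG i)ⱼₖ + (dG j)ᵢₖ − (dG k)ᵢⱼ)`:
`∑ᵢⱼₖ gⁱʲ Γᵢⱼₖ gᵏˡ = ∑ᵢ ((g⁻¹ (∂ᵢG) g⁻¹)ᵢₗ − ½ tr(g⁻¹ ∂ᵢG) gⁱˡ)`, i.e. `gⁱʲ Γˡᵢⱼ = −(1/√g)∂ᵢ(√g gⁱˡ)`
once `∂ᵢ√g = ½√g tr(g⁻¹∂ᵢG)` and `∂ᵢg⁻¹ = −g⁻¹(∂ᵢG)g⁻¹` are substituted. Lee 2018, Prop. 2.46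
with Problem 5-14 (5.29) (equality of the two coordinate expressions of `Δ`).
[cite: Lee2018, Prop. 2.46 and Problem 5-14 (5.28)–(5.29)] -/
theorem christoffel_contraction (gi : Matrix ι ι ℝ) (dG : ι → Matrix ι ι ℝ) (hgi : gi.IsSymm)
    (hdG : ∀ k, (dG k).IsSymm) (l : ι) :
    ∑ i, ∑ j, ∑ k, gi i j * (2⁻¹ * (dG i j k + dG j i k - dG k i j)) * gi k l =
      ∑ i, ((gi * dG i * gi) i l - 2⁻¹ * (gi * dG i).trace * gi i l) := by
  -- the three contractions
  have hS1 : ∑ i, (gi * dG i * gi) i l = ∑ i, ∑ j, ∑ k, gi i j * dG i j k * gi k l := by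
    refine sum_congr rfl (fun i _ ↦ ?_)
    simp only [Matrix.mul_apply, Finset.sum_mul]
    rw [Finset.sum_comm]
  have hS2 : ∑ i, ∑ j, ∑ k, gi i j * dG j i k * gi k l =
      ∑ i, ∑ j, ∑ k, gi i j * dG i j k * gi k l := by
    rw [Finset.sum_comm]
    refine sum_congr rfl (fun i _ ↦ sum_congr rfl (fun j _ ↦ sum_congr rfl (fun k _ ↦ ?_)))
    rw [hgi.apply i j]
  have hS3 : ∑ i, ∑ j, ∑ k, gi i j * dG k i j * gi k l =
      ∑ i, (gi * dG i).trace * gi i l := by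
    have h1 : ∀ i, (gi * dG i).trace * gi i l = ∑ j, ∑ k, gi j k * dG i j k * gi i l := by
      intro i
      simp only [Matrix.trace, Matrix.diag, Matrix.mul_apply, Finset.sum_mul]
      refine sum_congr rfl (fun j _ ↦ sum_congr rfl (fun k _ ↦ ?_))
      rw [(hdG i).apply j k]
    simp_rw [h1]
    -- `∑ i j k, gi i j * dG k i j * gi k l = ∑ i j k, gi j k * dG i j k * gi i l`: cyclic renaming
    calc ∑ i, ∑ j, ∑ k, gi i j * dG k i j * gi k l
        = ∑ i, ∑ k, ∑ j, gi i j * dG k i j * gi k l :=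
          sum_congr rfl (fun i _ ↦ Finset.sum_comm)
      _ = ∑ k, ∑ i, ∑ j, gi i j * dG k i j * gi k l := Finset.sum_comm
      _ = ∑ i, ∑ j, ∑ k, gi j k * dG i j k * gi i l := rfl
  -- expand the left-hand side into the three contractions
  have hL : ∑ i, ∑ j, ∑ k, gi i j * (2⁻¹ * (dG i j k + dG j i k - dG k i j)) * gi k l =
      2⁻¹ * ∑ i, ∑ j, ∑ k, gi i j * dG i j k * gi k l +
        2⁻¹ * ∑ i, ∑ j, ∑ k, gi i j * dG j i k * gi k l -
        2⁻¹ * ∑ i, ∑ j, ∑ k, gi i j * dG k i j * gi k l := by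
    simp only [Finset.mul_sum, ← Finset.sum_add_distrib, ← Finset.sum_sub_distrib]
    refine sum_congr rfl (fun i _ ↦ sum_congr rfl (fun j _ ↦ sum_congr rfl (fun k _ ↦ ?_)))
    ring
  rw [hL, hS2, hS3, Finset.sum_sub_distrib, hS1]
  have h3 : ∑ i, 2⁻¹ * (gi * dG i).trace * gi i l = 2⁻¹ * ∑ i, (gi * dG i).trace * gi i l := by
    rw [Finset.mul_sum]
    exact sum_congr rfl (fun i _ ↦ by ring)
  rw [h3]
  ring

omit [DecidableEq ι] in
/-- **The coordinate Laplacian in divergence form, algebraic skeleton.** With `gi = g⁻¹`,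
`dG i = ∂ᵢG` (both symmetric), `ρ0 = √g`, `df l = ∂ₗ f`, `d2 i l = ∂ᵢ∂ₗ f`:
`ρ0 ∑ᵢⱼ gⁱʲ (d2ᵢⱼ − ∑ₗ (∑ₖ Γᵢⱼₖ gᵏˡ) dfₗ) = ∑ᵢ (ρ0 ∑ₗ (gⁱˡ d2ᵢₗ + dfₗ · (−(g⁻¹ ∂ᵢG g⁻¹)ᵢₗ)) + (∑ₗ gⁱˡ dfₗ)(½ ρ0 tr(g⁻¹∂ᵢG)))`
— the right-hand side being `∑ᵢ ∂ᵢ(ρ ∑ₗ gⁱˡ ∂ₗf)` expanded by the product rule with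
`∂ᵢρ = ½ρ tr(g⁻¹∂ᵢG)` and `∂ᵢgⁱˡ = −(g⁻¹∂ᵢG g⁻¹)ᵢₗ`. Lee 2018, Prop. 2.46 with Problem 5-14
(5.29). [cite: Lee2018, Prop. 2.46 and Problem 5-14 (5.28)–(5.29)] -/
theorem coordLaplacian_algebra (gi : Matrix ι ι ℝ) (dG : ι → Matrix ι ι ℝ) (hgi : gi.IsSymm)
    (hdG : ∀ k, (dG k).IsSymm) (ρ0 : ℝ) (df : ι → ℝ) (d2 : ι → ι → ℝ) :
    ρ0 * ∑ i, ∑ j, gi i j *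
        (d2 i j - ∑ l, (∑ k, 2⁻¹ * (dG i j k + dG j i k - dG k i j) * gi k l) * df l) =
      ∑ i, (ρ0 * ∑ l, (gi i l * d2 i l + df l * -(gi * dG i * gi) i l) +
        (∑ l, gi i l * df l) * (2⁻¹ * ρ0 * (gi * dG i).trace)) := by
  -- the first-order part, contracted with `christoffel_contraction`
  have hsecond : ∑ i, ∑ j, gi i j *
      ∑ l, (∑ k, 2⁻¹ * (dG i j k + dG j i k - dG k i j) * gi k l) * df l =
      ∑ i, ∑ l, (gi * dG i * gi) i l * df l - ∑ i, ∑ l, 2⁻¹ * (gi * dG i).trace * gi i l * df l := by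
    calc ∑ i, ∑ j, gi i j * ∑ l, (∑ k, 2⁻¹ * (dG i j k + dG j i k - dG k i j) * gi k l) * df l
        = ∑ i, ∑ j, ∑ l,
            (∑ k, gi i j * (2⁻¹ * (dG i j k + dG j i k - dG k i j)) * gi k l) * df l := by
          refine sum_congr rfl (fun i _ ↦ sum_congr rfl (fun j _ ↦ ?_))
          rw [Finset.mul_sum]
          refine sum_congr rfl (fun l _ ↦ ?_)
          rw [Finset.sum_mul, Finset.sum_mul, Finset.mul_sum]
          exact sum_congr rfl (fun k _ ↦ by ring)
      _ = ∑ l, (∑ i, ∑ j, ∑ k, gi i j * (2⁻¹ * (dG i j k + dG j i k - dG k i j)) * gi k l) *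
            df l := by
          have h1 : ∀ i, ∑ j, ∑ l,
              (∑ k, gi i j * (2⁻¹ * (dG i j k + dG j i k - dG k i j)) * gi k l) * df l =
              ∑ l, ∑ j, (∑ k, gi i j * (2⁻¹ * (dG i j k + dG j i k - dG k i j)) * gi k l) * df l :=
            fun i ↦ Finset.sum_comm
          simp_rw [h1]
          rw [Finset.sum_comm]
          refine sum_congr rfl (fun l _ ↦ ?_)
          rw [Finset.sum_mul]
          refine sum_congr rfl (fun i _ ↦ ?_)
          rw [Finset.sum_mul]
      _ = ∑ l, (∑ i, ((gi * dG i * gi) i l - 2⁻¹ * (gi * dG i).trace * gi i l)) * df l := by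
          refine sum_congr rfl (fun l _ ↦ ?_)
          rw [christoffel_contraction gi dG hgi hdG l]
      _ = ∑ i, ∑ l, (gi * dG i * gi) i l * df l -
            ∑ i, ∑ l, 2⁻¹ * (gi * dG i).trace * gi i l * df l := by
          symm
          rw [← Finset.sum_sub_distrib]
          have h2 : ∀ i, ∑ l, (gi * dG i * gi) i l * df l -
              ∑ l, 2⁻¹ * (gi * dG i).trace * gi i l * df l =
              ∑ l, ((gi * dG i * gi) i l * df l - 2⁻¹ * (gi * dG i).trace * gi i l * df l) :=
            fun i ↦ by rw [← Finset.sum_sub_distrib]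
          simp_rw [h2]
          rw [Finset.sum_comm]
          refine sum_congr rfl (fun l _ ↦ ?_)
          rw [Finset.sum_mul]
          exact sum_congr rfl (fun i _ ↦ by ring)
  -- split the left-hand side
  have hsplit : ∑ i, ∑ j, gi i j *
      (d2 i j - ∑ l, (∑ k, 2⁻¹ * (dG i j k + dG j i k - dG k i j) * gi k l) * df l) =
      ∑ i, ∑ l, gi i l * d2 i l - ∑ i, ∑ j, gi i j *
        ∑ l, (∑ k, 2⁻¹ * (dG i j k + dG j i k - dG k i j) * gi k l) * df l := by
    rw [← Finset.sum_sub_distrib]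
    refine sum_congr rfl (fun i _ ↦ ?_)
    rw [← Finset.sum_sub_distrib]
    exact sum_congr rfl (fun j _ ↦ by ring)
  -- normal forms of the right-hand side
  have hA : ∑ i, (ρ0 * ∑ l, (gi i l * d2 i l + df l * -(gi * dG i * gi) i l) +
      (∑ l, gi i l * df l) * (2⁻¹ * ρ0 * (gi * dG i).trace)) =
      ρ0 * ∑ i, ∑ l, gi i l * d2 i l - ρ0 * ∑ i, ∑ l, (gi * dG i * gi) i l * df l +
        ρ0 * ∑ i, ∑ l, 2⁻¹ * (gi * dG i).trace * gi i l * df l := by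
    simp only [Finset.mul_sum, ← Finset.sum_sub_distrib, ← Finset.sum_add_distrib, Finset.sum_mul]
    refine sum_congr rfl (fun i _ ↦ ?_)
    exact sum_congr rfl (fun l _ ↦ by ring)
  rw [hsplit, hsecond, hA]
  ring

/-! ### The analytic identity -/

section Analytic

variable {E' : Type*} [NormedAddCommGroup E'] [NormedSpace ℝ E']
  {G : E' → ι → ι → ℝ} {G' : E' →L[ℝ] ι → ι → ℝ} {f : E' → ℝ} {f'' : E' →L[ℝ] E' →L[ℝ] ℝ}
  {y : E'}

omit [DecidableEq ι] in
/-- An entry of the derivative is the derivative of the entry: if `G` has derivative `G'` at `y`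
then `∂ᵥ G_{jk} = (G' v)_{jk}`. [folklore] -/
theorem fderiv_apply_apply_eq (hG : HasFDerivAt G G' y) (j k : ι) (v : E') :
    fderiv ℝ (fun z ↦ G z j k) y v = G' v j k := by
  rw [((hasFDerivAt_pi'.1 ((hasFDerivAt_pi'.1 hG) j)) k).fderiv]
  rfl

omit [DecidableEq ι] in
/-- The derivative of a field of symmetric matrices is symmetric. [folklore] -/
theorem isSymm_of_hasFDerivAt (hG : HasFDerivAt G G' y) (hsymm : ∀ z i j, G z i j = G z j i)
    (v : E') : (Matrix.of (G' v)).IsSymm := by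
  refine Matrix.IsSymm.ext (fun i j ↦ ?_)
  simp only [Matrix.of_apply]
  rw [← fderiv_apply_apply_eq hG j i v, ← fderiv_apply_apply_eq hG i j v]
  have h : (fun z ↦ G z j i) = fun z ↦ G z i j := funext fun z ↦ hsymm z j i
  rw [h]

/-- **The coordinate Laplacian in divergence form.** Let `G` be a field of symmetric matrices,
differentiable at `y` with `det G(y) > 0`, `e : ι → E'` fixed directions and `f` twice
differentiable at `y` (`hf2`: `z ↦ Df(z)` has derivative `f''` at `y`). Then, with `gⁱʲ = (G⁻¹)ᵢⱼ`,
`√g = √(det G)`, `∂ᵢ = D(·)(eᵢ)` and `Γᵢⱼₖ = ½(∂ᵢG_{jk} + ∂ⱼG_{ik} − ∂ₖG_{ij})`,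
`√g(y) · ∑ᵢⱼ gⁱʲ (∂ᵢ∂ⱼf − ∑ₗ (∑ₖ Γᵢⱼₖ gᵏˡ) ∂ₗf)(y) = ∑ᵢ ∂ᵢ(√g ∑ₗ gⁱˡ ∂ₗf)(y)`, i.e. the
Laplace–Beltrami operator `gⁱʲ(∂ᵢ∂ⱼ − Γˡᵢⱼ∂ₗ) = gⁱʲ∇ᵢ∇ⱼ` (Lee 2018, (5.29)) is
`(1/√g) ∂ᵢ(√g gⁱˡ ∂ₗ)` (Lee 2018, Prop. 2.46). [cite: Lee2018, Prop. 2.46 and Problem 5-14 (5.28)–(5.29)] -/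
theorem coordLaplacian_mul_sqrt_det_eq_sum_fderiv (e : ι → E') (hG : HasFDerivAt G G' y)
    (hsymm : ∀ z i j, G z i j = G z j i) (hdet : 0 < (Matrix.of (G y)).det)
    (hf2 : HasFDerivAt (fun z ↦ fderiv ℝ f z) f'' y) :
    Real.sqrt (Matrix.of (G y)).det *
        ∑ i, ∑ j, (Matrix.of (G y))⁻¹ i j * (f'' (e i) (e j) -
          ∑ l, (∑ k, 2⁻¹ * (G' (e i) j k + G' (e j) i k - G' (e k) i j) *
            (Matrix.of (G y))⁻¹ k l) * fderiv ℝ f y (e l)) =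
      ∑ i, fderiv ℝ (fun z ↦ Real.sqrt (Matrix.of (G z)).det *
        ∑ l, (Matrix.of (G z))⁻¹ i l * fderiv ℝ f z (e l)) y (e i) := by
  -- notation
  set g : Matrix ι ι ℝ := Matrix.of (G y) with hg
  set dG : ι → Matrix ι ι ℝ := fun i ↦ Matrix.of (G' (e i)) with hdG_def
  have hgs : g.IsSymm := Matrix.IsSymm.ext (fun i j ↦ hsymm y j i)
  have hgi : g⁻¹.IsSymm := hgs.inv
  have hdGs : ∀ k, (dG k).IsSymm := fun k ↦ isSymm_of_hasFDerivAt hG hsymm (e k)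
  -- the three factor functions and their derivatives at `y`
  have hR : DifferentiableAt ℝ (fun z ↦ Real.sqrt (Matrix.of (G z)).det) y :=
    (hasFDerivAt_sqrt_det hG hdet).differentiableAt
  have hRv : ∀ i, fderiv ℝ (fun z ↦ Real.sqrt (Matrix.of (G z)).det) y (e i) =
      2⁻¹ * Real.sqrt g.det * (g⁻¹ * dG i).trace := fun i ↦ hasFDerivAt_sqrt_det_apply hG hdet (e i)
  have hI : ∀ k l, DifferentiableAt ℝ (fun z ↦ (Matrix.of (G z))⁻¹ k l) y :=
    fun k l ↦ differentiableAt_inv_apply hG hdet.ne' k l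
  have hIv : ∀ i k l, fderiv ℝ (fun z ↦ (Matrix.of (G z))⁻¹ k l) y (e i) = -(g⁻¹ * dG i * g⁻¹) k l :=
    fun i k l ↦ fderiv_inv_apply hG hdet.ne' k l (e i)
  have hD : ∀ l, HasFDerivAt (fun z ↦ fderiv ℝ f z (e l))
      ((ContinuousLinearMap.apply ℝ ℝ (e l)).comp f'') y :=
    fun l ↦ (ContinuousLinearMap.apply ℝ ℝ (e l)).hasFDerivAt.comp y hf2
  have hDv : ∀ i l, fderiv ℝ (fun z ↦ fderiv ℝ f z (e l)) y (e i) = f'' (e i) (e l) := by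
    intro i l
    rw [(hD l).fderiv]
    rfl
  -- the sum `S_i = ∑ₗ gⁱˡ ∂ₗ f` and its derivative
  have hS : ∀ i, DifferentiableAt ℝ (fun z ↦ ∑ l, (Matrix.of (G z))⁻¹ i l * fderiv ℝ f z (e l)) y :=
    fun i ↦ DifferentiableAt.fun_sum (fun l _ ↦ (hI i l).fun_mul (hD l).differentiableAt)
  have hSv : ∀ i, fderiv ℝ (fun z ↦ ∑ l, (Matrix.of (G z))⁻¹ i l * fderiv ℝ f z (e l)) y (e i) =
      ∑ l, (g⁻¹ i l * f'' (e i) (e l) + fderiv ℝ f y (e l) * -(g⁻¹ * dG i * g⁻¹) i l) := by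
    intro i
    rw [fderiv_fun_sum (fun l _ ↦ (hI i l).fun_mul (hD l).differentiableAt)]
    simp only [FunLike.coe_sum, Finset.sum_apply]
    refine sum_congr rfl (fun l _ ↦ ?_)
    rw [fderiv_fun_mul (hI i l) (hD l).differentiableAt, _root_.add_apply, _root_.smul_apply,
      _root_.smul_apply, hDv, hIv, smul_eq_mul, smul_eq_mul]
  -- the derivative of each `Q_i = √g · S_i`
  have hQv : ∀ i, fderiv ℝ (fun z ↦ Real.sqrt (Matrix.of (G z)).det *
      ∑ l, (Matrix.of (G z))⁻¹ i l * fderiv ℝ f z (e l)) y (e i) =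
      Real.sqrt g.det * ∑ l, (g⁻¹ i l * f'' (e i) (e l) +
        fderiv ℝ f y (e l) * -(g⁻¹ * dG i * g⁻¹) i l) +
      (∑ l, g⁻¹ i l * fderiv ℝ f y (e l)) * (2⁻¹ * Real.sqrt g.det * (g⁻¹ * dG i).trace) := by
    intro i
    rw [fderiv_fun_mul hR (hS i), _root_.add_apply, _root_.smul_apply, _root_.smul_apply, hSv, hRv,
      smul_eq_mul, smul_eq_mul]
  rw [Finset.sum_congr rfl (fun i _ ↦ hQv i)]
  exact coordLaplacian_algebra g⁻¹ dG hgi hdGs (Real.sqrt g.det) (fun l ↦ fderiv ℝ f y (e l))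
    (fun i l ↦ f'' (e i) (e l))

end Analytic

end Literature.Analysis.Calculus

end
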